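/-
Copyright (c) 2026 the pub-hodgecm-mathlib formalisation cell (harness21).  Prover seat hodgecm-mathlib-K2E3-p27 (g0), HCML Track B «K2-LIT» ∕ h413
(`stmt-HodgeConjecture-24833`), line `K2_E3_EllipticInputs`, unit U12 «Characters», PART «RANK» leaf (11-2qs-Id′) ∕ (qs2-ps) «van Dijk₂», deal D117 (HCD₂)
(dealer K2E3-plan (g4)), FILE 2b OF 4 «HCD₂-G→𝔤»: local `∫⁻`-finiteness of `|D_G|^{−1∕2} = (√√(‖disc χ_g‖·‖det g‖⁻¹))⁻¹` on a unitary group in TWO variables follows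
from that of `(√√‖disc χ_X‖)⁻¹` on its Lie algebra — the `2 × 2` twin of ★ `F0P3cStCharTSHCDGroupToLie` (translated Cayley chart ★ `exists_depth_lintegral_translate_eq`,
generic in the matrix size).  2026-09-04.
-/
import Summits.HodgeConjecture.HodgeConjecture.Theorems.K2E3U11WeylDiscrCayleyAlgebra     -- FILE 2a (this seat): `theta_two_smul_cayley_le` (the `2 × 2` bound); brings ★ `F0P3cStCharTSHCDCayleyChartAt` (`exists_depth_lintegral_translate_eq`, `isClosedEmbedding_subtype`)
import Literature.NumberTheory.Automorphic.LocalFieldHaarBalls                            -- ★ `LocalFieldHaar.continuous_normAbs`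
import Mathlib.LinearAlgebra.Matrix.Charpoly.Disc
import Mathlib.MeasureTheory.Measure.Haar.MulEquivHaarChar
import Mathlib.Topology.Algebra.Ring.Real
import HarnessLib

/-!
# Deal D117 (HCD₂), FILE 2b «HCD₂-G→𝔤»: local integrability of `|D_G|^{−1∕2}` on a unitary group in two variables ⟸ local integrability of `|η|^{−1∕4}` on its Lie algebra
# (Harish-Chandra 1970 Part VII §1 Thm. 15, `2 × 2`, through the translated Cayley chart)

Cell `pub/hodgecm-mathlib` (D-0151), Track B «K2-LIT», crux H413 = `stmt-HodgeConjecture-24833`, route `HCCMUnconditional`.  Lane `--supports stmt-HodgeConjecture-24833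
--as helper`; THEOREMS ONLY (no `def`, no `instance`, no `notation`, no named-fact hypothesis, no `sorry`); count-neutral.  The `2 × 2` twin, token for token with `3 ↦ 2`
and the `det`-exponent `2 ↦ 1` (`|D_G| = |disc χ_g| ∕ |det g|^{n−1}`), of ★ `F0P3cStCharTSHCDGroupToLie` (F0P3a-p06 (g21)); the chart theorem ★ `exists_depth_lintegral_translate_eq`
it threads is generic in the matrix size and is used BY NAME.

THE MATHEMATICS.  On the Lie algebra the integrand is `ηι X := (↑√√‖disc χ_X‖_K)⁻¹`, on the group `θ₂ M := (↑√√(‖disc χ_M‖_K · ‖det M‖_K⁻¹))⁻¹` — the one-place reading of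
`|D_G|^{−1∕2}` for `U(1,1)`.  FILE 2a `K2E3U11WeylDiscrCayleyAlgebra` (§1–§2) proves the bound **`θ₂(z • c(X)) ≤ C(X) · ηι(X)`**, `C(X) = √√‖det(1−X)det(1+X)‖ ∕ √‖2‖`.
§3 `g ↦ θ₂(ρ g)` is continuous; `s ↦ θ₂(z • c(X₀ + s))` is Borel on `𝔲`.  §4 HEAD **`exists_nhds_setLIntegral_theta_two_lt_top`**: if every point of `𝔲` has a neighbourhood on
which `ηι` is `μ`-integrable, every `g₀ ∈ G` has a neighbourhood on which `θ₂ ∘ ρ` is `ν`-integrable (★ chart, §2, compactness of `Λ_k`, change of variables `Y ↦ X₀ + L̃ Y`).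
FILE 1 ★ `K2E3U11WeylDiscrLieLocInt` supplies the hypothesis on `𝔲(1,1)`; FILE 3 instantiates at the CM place; FILE 4 transports to the organ carrier `G₂`.

HONEST LABEL: HC_CM is proved only modulo the 7 printed citations (2 remaining named inputs: hLiu418 = stmt-HodgeConjecture-24832, h413 = stmt-HodgeConjecture-24833) until rung 0
closes; count-neutral helper; closes no socket by itself.

## References
* [HarishChandra1970] Harish-Chandra, *Harmonic analysis on reductive p-adic groups*, LNM 162 (1970), Part VII §1 Thm. 15.
* [Rogawski1990] J. D. Rogawski, *Automorphic Representations of Unitary Groups in Three Variables* (1990), §4.9 p. 54 (`D_G`), §12.5 p. 182.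
* [PlatonovRapinchuk1994] V. Platonov, A. Rapinchuk, *Algebraic Groups and Number Theory* (1994), §3.3 (the Cayley transform).
* [BasuPollackRoy2006] S. Basu, R. Pollack, M.-F. Roy, *Algorithms in Real Algebraic Geometry*, 2nd ed. (2006), §4.1 (discriminants).
-/

set_option autoImplicit false
set_option linter.dupNamespace false

noncomputable section

open Set Filter MeasureTheory MeasureTheory.Measure TopologicalSpace Topology Matrix ValuativeRel Metric Polynomial
open Literature.NumberTheory.Automorphic Literature.NumberTheory.Weil1982.UnitaryFinTopForm Literature.LinearAlgebra.Matrix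
open Literature.NumberTheory.GaloisRepresentations.IsNonarchimedeanLocalField
open Summit.HodgeConjecture.HodgeConjecture.Cruxes.H413.F0P3cStCharTSHCDCayleyChartAt
open Summit.HodgeConjecture.HodgeConjecture.Cruxes.H413.K2E3U11WeylDiscrCayleyAlgebra
open scoped Pointwise Topology ENNReal NNReal MatrixGroups

namespace Summit.HodgeConjecture.HodgeConjecture.Cruxes.H413.K2E3U11WeylDiscrGroupToLie

/-! ## §3 Continuity ∕ measurability of the two integrands -/

section Measurable

variable {K : Type*} [Field K] [ValuativeRel K] [TopologicalSpace K] [IsNonarchimedeanLocalField K]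

/-- `M ↦ discr χ_M` is continuous on `2 × 2` matrices (`disc = tr² − 4det`). [cite: Rogawski1990, §4.9 p. 54] -/
theorem continuous_discr_charpoly_fin_two : Continuous fun M : Matrix (Fin 2) (Fin 2) K => M.charpoly.discr := by
  have heq : (fun M : Matrix (Fin 2) (Fin 2) K => M.charpoly.discr) = fun M : Matrix (Fin 2) (Fin 2) K => M.trace ^ 2 - 4 * M.det := by
    funext M
    rw [← Matrix.discr, Matrix.discr_fin_two]
  rw [heq]
  exact ((continuous_id.matrix_trace).pow 2).sub (continuous_const.mul continuous_id.matrix_det)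

/-- **`θ₂` is continuous at matrices with non-zero determinant** (`ℝ≥0∞`-valued). [cite: Rogawski1990, §4.9 p. 54] -/
theorem continuousAt_theta_two {M : Matrix (Fin 2) (Fin 2) K} (hM : M.det ≠ 0) :
    ContinuousAt (fun M : Matrix (Fin 2) (Fin 2) K =>
      ((NNReal.sqrt (NNReal.sqrt (normAbs K M.charpoly.discr * (normAbs K M.det)⁻¹)) : ℝ≥0) : ℝ≥0∞)⁻¹) M := by
  have h1 : Continuous fun M : Matrix (Fin 2) (Fin 2) K => normAbs K M.charpoly.discr :=
    LocalFieldHaar.continuous_normAbs.comp continuous_discr_charpoly_fin_two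
  have h2 : Continuous fun M : Matrix (Fin 2) (Fin 2) K => normAbs K M.det := LocalFieldHaar.continuous_normAbs.comp continuous_id.matrix_det
  have h3 : ContinuousAt (fun M : Matrix (Fin 2) (Fin 2) K => (normAbs K M.det)⁻¹) M :=
    h2.continuousAt.inv₀ ((map_ne_zero (normAbs K)).2 hM)
  have h4 : ContinuousAt (fun M : Matrix (Fin 2) (Fin 2) K => normAbs K M.charpoly.discr * (normAbs K M.det)⁻¹) M := h1.continuousAt.mul h3
  exact continuous_inv.continuousAt.comp
    (ENNReal.continuous_coe.continuousAt.comp ((NNReal.continuous_sqrt.comp NNReal.continuous_sqrt).continuousAt.comp h4))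

/-- At a singular matrix `θ₂ = ⊤`. [cite: Rogawski1990, §4.9 p. 54] -/
theorem theta_two_eq_top_of_det_eq_zero {M : Matrix (Fin 2) (Fin 2) K} (hM : M.det = 0) :
    ((NNReal.sqrt (NNReal.sqrt (normAbs K M.charpoly.discr * (normAbs K M.det)⁻¹)) : ℝ≥0) : ℝ≥0∞)⁻¹ = ⊤ := by
  rw [hM, map_zero, _root_.inv_zero, mul_zero, NNReal.sqrt_zero, NNReal.sqrt_zero, ENNReal.coe_zero, ENNReal.inv_zero]

variable {G : Type*} [Group G] [TopologicalSpace G] (ρ : G →* GL (Fin 2) K)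

/-- **`g ↦ θ₂(ρ g)` is continuous** (hence Borel) on `G` for `ρ` continuous. [cite: HarishChandra1970, Part VII §1 Thm. 15] -/
theorem continuous_theta_two_comp (hρc : Continuous ρ) :
    Continuous fun g : G =>
      ((NNReal.sqrt (NNReal.sqrt (normAbs K ((ρ g : GL (Fin 2) K) : Matrix (Fin 2) (Fin 2) K).charpoly.discr *
        (normAbs K ((ρ g : GL (Fin 2) K) : Matrix (Fin 2) (Fin 2) K).det)⁻¹)) : ℝ≥0) : ℝ≥0∞)⁻¹ := by
  have hM : Continuous fun g : G => ((ρ g : GL (Fin 2) K) : Matrix (Fin 2) (Fin 2) K) := Units.continuous_val.comp hρc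
  rw [continuous_iff_continuousAt]
  intro g
  have hdet : ((ρ g : GL (Fin 2) K) : Matrix (Fin 2) (Fin 2) K).det ≠ 0 := by
    have h := (Matrix.GeneralLinearGroup.det (ρ g)).ne_zero
    rwa [Matrix.GeneralLinearGroup.val_det_apply] at h
  exact ContinuousAt.comp (f := fun g : G => ((ρ g : GL (Fin 2) K) : Matrix (Fin 2) (Fin 2) K)) (x := g) (continuousAt_theta_two hdet)
    hM.continuousAt

variable (𝔲 : AddSubgroup (Matrix (Fin 2) (Fin 2) K)) [MeasurableSpace 𝔲] [BorelSpace 𝔲]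

/-- **`s ↦ θ₂(z • c(X₀ + s))` is Borel on `𝔲`**: continuous where `1 ± (X₀ + s)` are invertible, identically `⊤` off that open set.
[cite: PlatonovRapinchuk1994, §3.3] [cite: Rogawski1990, §4.9 p. 54] -/
theorem measurable_theta_two_smul_cayley {z : K} (hz : z ≠ 0) (X₀ : Matrix (Fin 2) (Fin 2) K) :
    Measurable fun s : 𝔲 =>
      ((NNReal.sqrt (NNReal.sqrt (normAbs K (z • cayley (X₀ + (s : Matrix (Fin 2) (Fin 2) K))).charpoly.discr *
        (normAbs K (z • cayley (X₀ + (s : Matrix (Fin 2) (Fin 2) K))).det)⁻¹)) : ℝ≥0) : ℝ≥0∞)⁻¹ := by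
  classical
  haveI : T2Space K := (isLocalField K).toT2Space
  set θ : Matrix (Fin 2) (Fin 2) K → ℝ≥0∞ := fun M =>
    ((NNReal.sqrt (NNReal.sqrt (normAbs K M.charpoly.discr * (normAbs K M.det)⁻¹)) : ℝ≥0) : ℝ≥0∞)⁻¹ with hθ
  set ψ : 𝔲 → Matrix (Fin 2) (Fin 2) K := fun s => z • cayley (X₀ + (s : Matrix (Fin 2) (Fin 2) K)) with hψ
  set O : Set 𝔲 := {s | (1 - (X₀ + (s : Matrix (Fin 2) (Fin 2) K))).det ≠ 0 ∧ (1 + (X₀ + (s : Matrix (Fin 2) (Fin 2) K))).det ≠ 0} with hO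
  have hco : Continuous fun s : 𝔲 => X₀ + (s : Matrix (Fin 2) (Fin 2) K) := continuous_const.add continuous_subtype_val
  have hOo : IsOpen O :=
    (isOpen_ne_fun ((continuous_const.sub hco).matrix_det) continuous_const).inter
      (isOpen_ne_fun ((continuous_const.add hco).matrix_det) continuous_const)
  have hoff : ∀ s, s ∉ O → θ (ψ s) = ⊤ := by
    intro s hs
    apply theta_two_eq_top_of_det_eq_zero
    simp only [hψ, Matrix.det_smul, cayley_def, Matrix.det_mul, Matrix.det_nonsing_inv, Ring.inverse_eq_inv']
    rw [hO, Set.mem_setOf_eq, not_and_or, not_ne_iff, not_ne_iff] at hs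
    rcases hs with h | h
    · rw [h, _root_.inv_zero, mul_zero, mul_zero]
    · rw [h, zero_mul, mul_zero]
  have hon : ContinuousOn (fun s => θ (ψ s)) O := by
    intro s hs
    have hdet1 : IsUnit (1 - (X₀ + (s : Matrix (Fin 2) (Fin 2) K))).det := isUnit_iff_ne_zero.2 hs.1
    have hψc : ContinuousAt ψ s := by
      have hinv : ContinuousAt Inv.inv (1 - (X₀ + (s : Matrix (Fin 2) (Fin 2) K))) := by
        refine continuousAt_matrix_inv _ ?_
        rw [Ring.inverse_eq_inv']
        exact continuousAt_inv₀ hdet1.ne_zero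
      have h1 : ContinuousAt (fun s : 𝔲 => (1 - (X₀ + (s : Matrix (Fin 2) (Fin 2) K)))⁻¹) s :=
        ContinuousAt.comp (f := fun s : 𝔲 => 1 - (X₀ + (s : Matrix (Fin 2) (Fin 2) K))) (x := s) hinv (continuous_const.sub hco).continuousAt
      have h2 : ContinuousAt (fun s : 𝔲 => (1 + (X₀ + (s : Matrix (Fin 2) (Fin 2) K))) * (1 - (X₀ + (s : Matrix (Fin 2) (Fin 2) K)))⁻¹) s :=
        (continuous_const.add hco).continuousAt.mul h1
      have h3 : ContinuousAt (fun s : 𝔲 => z • ((1 + (X₀ + (s : Matrix (Fin 2) (Fin 2) K))) * (1 - (X₀ + (s : Matrix (Fin 2) (Fin 2) K)))⁻¹)) s :=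
        ContinuousAt.comp (f := fun s : 𝔲 => (1 + (X₀ + (s : Matrix (Fin 2) (Fin 2) K))) * (1 - (X₀ + (s : Matrix (Fin 2) (Fin 2) K)))⁻¹) (x := s)
          (continuous_const_smul z).continuousAt h2
      simpa only [hψ, cayley_def] using h3
    have hdetψ : (ψ s).det ≠ 0 := by
      simp only [hψ, Matrix.det_smul, cayley_def, Matrix.det_mul, Matrix.det_nonsing_inv, Ring.inverse_eq_inv']
      exact mul_ne_zero (pow_ne_zero _ hz) (mul_ne_zero hs.2 (inv_ne_zero hs.1))
    exact (ContinuousAt.comp (f := ψ) (x := s) (continuousAt_theta_two hdetψ) hψc).continuousWithinAt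
  have heq : (fun s => θ (ψ s)) = O.piecewise (fun s => θ (ψ s)) (fun _ => ⊤) := by
    funext s
    by_cases hs : s ∈ O
    · rw [Set.piecewise_eq_of_mem _ _ _ hs]
    · rw [Set.piecewise_eq_of_notMem _ _ _ hs, hoff s hs]
  show Measurable fun s => θ (ψ s)
  rw [heq]
  exact ContinuousOn.measurable_piecewise hon continuousOn_const hOo.measurableSet

end Measurable

/-! ## §4 HEAD: local integrability transfers from the Lie algebra to the group (`2 × 2`) -/

section Head

variable {K : Type*} [Field K] [ValuativeRel K] [TopologicalSpace K] [IsNonarchimedeanLocalField K]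
  (σ : K →+* K) (J : Matrix (Fin 2) (Fin 2) K) (𝔲 : AddSubgroup (Matrix (Fin 2) (Fin 2) K))
  [MeasurableSpace 𝔲] [BorelSpace 𝔲] (μ : Measure 𝔲) [μ.IsAddHaarMeasure]
  {G : Type*} [Group G] [TopologicalSpace G] [IsTopologicalGroup G] [LocallyCompactSpace G] [SecondCountableTopology G] [T2Space G]
  [MeasurableSpace G] [BorelSpace G] (ρ : G →* GL (Fin 2) K) (ν : Measure G) [ν.IsHaarMeasure]

set_option maxHeartbeats 800000 in
-- the head threads ★ `exists_depth_lintegral_translate_eq` with the bound of §2 and one change of variables (same budget as the ★ `3 × 3` head)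
/-- **(G→𝔤)₂ — LOCAL INTEGRABILITY OF `|D_G|^{−1∕2}` FROM THE LIE ALGEBRA, TWO VARIABLES.**  In the setting of ★ `exists_depth_lintegral_translate_eq` (`K` non-archimedean
local, `2 ≠ 0`, `σ` continuous, `J` invertible, `𝔲 = {ᵗ(σX)J + JX = 0} ≤ M₂(K)` with additive Haar measure `μ`, `ρ : G →* GL₂(K)` inducing injective onto the unitary group,
Haar `ν`, infinitely many norm-one scalars): IF every `X₀ ∈ 𝔲` has a neighbourhood `U` with `∫⁻_U (↑√√‖disc χ_X‖)⁻¹ dμ < ∞`, THEN every `g₀ ∈ G` has a neighbourhood `U` with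
**`∫⁻_U (↑√√(‖disc χ_{ρ g}‖ · ‖det ρ g‖⁻¹))⁻¹ dν(g) < ∞`**.  Proof: verbatim the ★ `3 × 3` head with the `2 × 2` bound of §2.
[cite: HarishChandra1970, Part VII §1 Thm. 15] [cite: Rogawski1990, §12.5 p. 182] [cite: PlatonovRapinchuk1994, §3.3] -/
theorem exists_nhds_setLIntegral_theta_two_lt_top (hσc : Continuous σ) (h2 : (2 : K) ≠ 0) (hJ : IsUnit J.det)
    (h𝔲 : ∀ X, X ∈ 𝔲 ↔ (X.map σ)ᵀ * J + J * X = 0)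
    (hρ : IsInducing ρ) (hρinj : Function.Injective ρ)
    (hρr : ∀ g : GL (Fin 2) K, g ∈ Set.range ρ ↔ (((g : Matrix (Fin 2) (Fin 2) K)).map σ)ᵀ * J * (g : Matrix (Fin 2) (Fin 2) K) = J)
    (hE : {z : K | σ z * z = 1}.Infinite)
    (hLie : ∀ X₀ : 𝔲, ∃ U ∈ 𝓝 X₀, ∫⁻ X in U,
      ((NNReal.sqrt (NNReal.sqrt (normAbs K (X : Matrix (Fin 2) (Fin 2) K).charpoly.discr)) : ℝ≥0) : ℝ≥0∞)⁻¹ ∂μ < ∞)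
    (g₀ : G) :
    ∃ U ∈ 𝓝 g₀, ∫⁻ g in U,
      ((NNReal.sqrt (NNReal.sqrt (normAbs K ((ρ g : GL (Fin 2) K) : Matrix (Fin 2) (Fin 2) K).charpoly.discr *
        (normAbs K ((ρ g : GL (Fin 2) K) : Matrix (Fin 2) (Fin 2) K).det)⁻¹)) : ℝ≥0) : ℝ≥0∞)⁻¹ ∂ν < ∞ := by
  classical
  -- instances on `𝔲` (closed in the locally compact, second countable, metrisable `M₂(K)`)
  haveI : T2Space K := (isLocalField K).toT2Space
  haveI : SecondCountableTopology K := secondCountableTopology_localField K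
  haveI : TopologicalSpace.PseudoMetrizableSpace K := pseudoMetrizableSpace_localField K
  haveI : LocallyCompactSpace (Matrix (Fin 2) (Fin 2) K) := inferInstanceAs (LocallyCompactSpace (Fin 2 → Fin 2 → K))
  haveI : SecondCountableTopology (Matrix (Fin 2) (Fin 2) K) := inferInstanceAs (SecondCountableTopology (Fin 2 → Fin 2 → K))
  haveI : TopologicalSpace.PseudoMetrizableSpace (Matrix (Fin 2) (Fin 2) K) :=
    inferInstanceAs (TopologicalSpace.PseudoMetrizableSpace (Fin 2 → Fin 2 → K))
  haveI : LocallyCompactSpace 𝔲 := (isClosedEmbedding_subtype σ J 𝔲 hσc h𝔲).locallyCompactSpace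
  haveI : SecondCountableTopology 𝔲 := TopologicalSpace.Subtype.secondCountableTopology _
  haveI : SigmaCompactSpace 𝔲 := sigmaCompactSpace_of_locallyCompact_secondCountable
  haveI : μ.Regular := inferInstance
  -- the two integrands as functions
  set θ : Matrix (Fin 2) (Fin 2) K → ℝ≥0∞ := fun M =>
    ((NNReal.sqrt (NNReal.sqrt (normAbs K M.charpoly.discr * (normAbs K M.det)⁻¹)) : ℝ≥0) : ℝ≥0∞)⁻¹ with hθ
  set ηι : 𝔲 → ℝ≥0∞ := fun X => ((NNReal.sqrt (NNReal.sqrt (normAbs K (X : Matrix (Fin 2) (Fin 2) K).charpoly.discr)) : ℝ≥0) : ℝ≥0∞)⁻¹ with hηι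
  -- ★ (D6a)+(D6c)
  obtain ⟨z, X₀, LS, Λ, k₀, hz1, hz0, hX₀, hm, hp, hg₀, hLS, hΛo, hΛc, hΛanti, hΛbasis, hk⟩ :=
    exists_depth_lintegral_translate_eq σ J 𝔲 μ ρ ν hσc h2 hJ h𝔲 hρ hρinj hρr hE g₀
  -- the neighbourhood of `X₀` on the Lie side, an open part of it, and a depth inside it
  obtain ⟨UL, hUL, hint⟩ := hLie ⟨X₀, hX₀⟩
  obtain ⟨V, hVU, hVo, hXV⟩ := mem_nhds_iff.1 hUL
  set T : 𝔲 → 𝔲 := fun Y => ⟨X₀, hX₀⟩ + LS Y with hT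
  have hTc : Continuous T := continuous_const.add LS.continuous
  have hT0 : T 0 = ⟨X₀, hX₀⟩ := by rw [hT]; simp
  have hpre : T ⁻¹' V ∈ 𝓝 (0 : 𝔲) := hTc.continuousAt.preimage_mem_nhds (by rw [hT0]; exact hVo.mem_nhds hXV)
  obtain ⟨k₃, hk₃⟩ := hΛbasis _ hpre
  set k := max k₀ k₃ with hkdef
  obtain ⟨hgoodk, U, hUo, hg₀U, κ, hκ0, hκt, hId⟩ := hk k (le_max_left _ _)
  have hΛkV : (Λ k : Set 𝔲) ⊆ T ⁻¹' V := fun Y hY => hk₃ (hΛanti (le_max_right _ _) hY)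
  refine ⟨U, hUo.mem_nhds hg₀U, ?_⟩
  -- the identity of ★ (D6a)+(D6c) for `H := θ`
  have hρc : Continuous ρ := hρ.continuous
  have hH₁ : Measurable fun g : G => θ ((ρ g : GL (Fin 2) K) : Matrix (Fin 2) (Fin 2) K) := (continuous_theta_two_comp ρ hρc).measurable
  have hH₂ : Measurable fun s : 𝔲 => θ (z • cayley (X₀ + (s : Matrix (Fin 2) (Fin 2) K))) := measurable_theta_two_smul_cayley 𝔲 hz0 X₀
  have hId' := hId θ hH₁ hH₂
  simp only [hθ] at hId' ⊢
  rw [hId']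
  -- pointwise bound on `Λ k` by `C* · ηι (T Y)`
  have hcont : Continuous fun Y : 𝔲 =>
      normAbs K ((1 - (X₀ + ((LS Y : 𝔲) : Matrix (Fin 2) (Fin 2) K))).det * (1 + (X₀ + ((LS Y : 𝔲) : Matrix (Fin 2) (Fin 2) K))).det) := by
    have hc : Continuous fun Y : 𝔲 => X₀ + ((LS Y : 𝔲) : Matrix (Fin 2) (Fin 2) K) :=
      continuous_const.add (continuous_subtype_val.comp LS.continuous)
    exact LocalFieldHaar.continuous_normAbs.comp (((continuous_const.sub hc).matrix_det).mul ((continuous_const.add hc).matrix_det))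
  obtain ⟨B, hB⟩ := (hΛc k).bddAbove_image hcont.continuousOn
  set Cst : ℝ≥0 := NNReal.sqrt (NNReal.sqrt B) / NNReal.sqrt (normAbs K 2) with hCst
  have hbound : ∀ Y ∈ (Λ k : Set 𝔲),
      ((NNReal.sqrt (NNReal.sqrt (normAbs K (z • cayley (X₀ + ((LS Y : 𝔲) : Matrix (Fin 2) (Fin 2) K))).charpoly.discr *
        (normAbs K (z • cayley (X₀ + ((LS Y : 𝔲) : Matrix (Fin 2) (Fin 2) K))).det)⁻¹)) : ℝ≥0) : ℝ≥0∞)⁻¹ ≤ (Cst : ℝ≥0∞) * ηι (T Y) := by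
    intro Y hY
    obtain ⟨hm', hp'⟩ := hgoodk Y hY
    refine (theta_two_smul_cayley_le h2 hz0 hm' hp').trans ?_
    have hTY : ((T Y : 𝔲) : Matrix (Fin 2) (Fin 2) K) = X₀ + ((LS Y : 𝔲) : Matrix (Fin 2) (Fin 2) K) := by rw [hT]; simp
    rw [hηι]; dsimp only; rw [hTY]
    refine mul_le_mul_of_nonneg_right ?_ zero_le
    rw [ENNReal.coe_le_coe, hCst]
    exact div_le_div_of_nonneg_right (NNReal.sqrt_le_sqrt.2 (NNReal.sqrt_le_sqrt.2 (hB ⟨Y, hY, rfl⟩)))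
      (NNReal.sqrt_pos.2 (pos_iff_ne_zero.2 ((map_ne_zero (normAbs K)).2 h2))).le
  -- integrate the bound
  have hstep1 : ∫⁻ Y in (Λ k : Set 𝔲),
      ((NNReal.sqrt (NNReal.sqrt (normAbs K (z • cayley (X₀ + ((LS Y : 𝔲) : Matrix (Fin 2) (Fin 2) K))).charpoly.discr *
        (normAbs K (z • cayley (X₀ + ((LS Y : 𝔲) : Matrix (Fin 2) (Fin 2) K))).det)⁻¹)) : ℝ≥0) : ℝ≥0∞)⁻¹ ∂μ ≤
      (Cst : ℝ≥0∞) * ∫⁻ Y in (Λ k : Set 𝔲), ηι (T Y) ∂μ := by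
    rw [← lintegral_const_mul' _ _ ENNReal.coe_ne_top]
    exact setLIntegral_mono' (hΛo k).measurableSet fun Y hY => hbound Y hY
  -- change of variables `Y ↦ T Y = X₀ + L̃ Y`: `μ.map T = (addEquivAddHaarChar L̃)⁻¹ • μ`
  have hstep2 : ∫⁻ Y in (Λ k : Set 𝔲), ηι (T Y) ∂μ ≤ ((addEquivAddHaarChar LS)⁻¹ : ℝ≥0) * ∫⁻ X in V, ηι X ∂μ := by
    have hTm : Measurable T := hTc.measurable
    let e : 𝔲 ≃ᵐ 𝔲 := (LS.toHomeomorph.trans (Homeomorph.addLeft (⟨X₀, hX₀⟩ : 𝔲))).toMeasurableEquiv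
    have he : (e : 𝔲 → 𝔲) = T := by
      funext Y; rw [hT]; rfl
    have hmapLS : μ.map LS = ((addEquivAddHaarChar LS)⁻¹ : ℝ≥0) • μ := by
      have h := addEquivAddHaarChar_smul_map μ LS
      rw [← h, smul_smul, inv_mul_cancel₀ (addEquivAddHaarChar_pos LS).ne', one_smul, h]
    have hmapT : μ.map T = ((addEquivAddHaarChar LS)⁻¹ : ℝ≥0) • μ := by
      have : T = (fun Y : 𝔲 => (⟨X₀, hX₀⟩ : 𝔲) + Y) ∘ LS := by funext Y; rfl
      have hLSm : Measurable (LS : 𝔲 → 𝔲) := LS.continuous.measurable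
      rw [this, ← Measure.map_map (measurable_const_add _) hLSm]
      change Measure.map (fun Y : 𝔲 => (⟨X₀, hX₀⟩ : 𝔲) + Y) (μ.map LS) = _
      rw [hmapLS, Measure.map_smul, map_add_left_eq_self]
    calc ∫⁻ Y in (Λ k : Set 𝔲), ηι (T Y) ∂μ ≤ ∫⁻ Y in T ⁻¹' V, ηι (T Y) ∂μ := lintegral_mono_set hΛkV
      _ = ∫⁻ X in V, ηι X ∂(μ.map T) := by
          rw [← he, MeasurableEquiv.restrict_map, lintegral_map_equiv]
      _ = ((addEquivAddHaarChar LS)⁻¹ : ℝ≥0) * ∫⁻ X in V, ηι X ∂μ := by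
          rw [hmapT, Measure.restrict_smul, lintegral_smul_measure, ENNReal.smul_def, smul_eq_mul]
  have hfinV : ∫⁻ X in V, ηι X ∂μ < ∞ := lt_of_le_of_lt (lintegral_mono_set hVU) hint
  refine ENNReal.mul_lt_top (lt_top_iff_ne_top.2 hκt) ?_
  refine lt_of_le_of_lt hstep1 (ENNReal.mul_lt_top ENNReal.coe_lt_top ?_)
  exact lt_of_le_of_lt hstep2 (ENNReal.mul_lt_top ENNReal.coe_lt_top hfinV)

end Head

end Summit.HodgeConjecture.HodgeConjecture.Cruxes.H413.K2E3U11WeylDiscrGroupToLie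

end
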